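import Summits.Schanuel.Schanuel.Theorems.RootDecomp1ELWTransport06

/-!
# RootDecomp1ELWTransport — lens 2, generation 39 «LW-PAIR NORM TRANSPORT CELL» (lane E-R18 (a)): S ITSELF on the class `InLWClass` (E-doubled moment curves over a dyadic 2-fold-hyper-Liouville T), engine `algebraicIndependent_lwPt` mod `hLW : LWMeasure` — continuation (RootDecomp1ELWTransport07): §5 the class `InLWClass`, `schanuel_on_lwClass`, the CELLS of 25020/31409/31410, the credit member `zStar` (n = 4) + §5b the member family `zTwin` (S at n = 2k)

(lens-2 g39 `LWTransport.lean` [HOME/decomp-schanuel-lens-2/g39/ sha256 cff5d88d…e8f0, 2208 l; NODE L1907 / REQUEST L1908; critic VERDICT L1909 (CLEARED, E-R18 (a) cell credit, port GO)]; port by census-1 gen 17 as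
`RootDecomp1ELWTransport01`–`09` — see the PORT NOTE of part 01; `--supports stmt-Schanuel-31409`; rung 0.)
-/

noncomputable section

open Complex Polynomial
open Literature.NumberTheory.Transcendental (zlen zlen_nonneg zlen_add_le zlen_monomial_le zlen_sum_le
  zlen_mul_le zlen_pow_le)

namespace Summit.Schanuel.Schanuel.Theorems.RootDecomp1ELWTransport

open Summit.Schanuel.Schanuel.Theorems.RootDecomp1KHyper (SB SFset sb_of_algebraicIndependent LWMeasure
  exists_ball_eval_ne_zero exists_int_mul_eq_map mvaeval_int_map)
open Summit.Schanuel.Schanuel.Theorems.RootDecomp1KHyper.HyperCell (Ewt exC collPoly collPoly_ne_zero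
  exC_inj)
open NormDescent (P2)

variable {k : ℕ}

/-! ## §5  The class, the CELLS of the 1E items, and the credit member `z₄` -/

/-- the doubled moment set `{T^j, β·T^j : 1 ≤ j ≤ k}` -/
def dblMoments (k : ℕ) (β : ℂ) (T : ℝ) : Set ℂ :=
  {x | ∃ j : Fin k, x = (T : ℂ) ^ ((j : ℕ) + 1) ∨ x = β * (T : ℂ) ^ ((j : ℕ) + 1)}

/-- **`InLWClass z` — THE CELL LINE (one class line).** The coordinates of `z` lie in the doubled moment
set `{T^j, βT^j : 1 ≤ j ≤ k}` of a dyadic 2-fold hyper-Liouville `T > 0` (`DyadicHyper₂`, closed def)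
and an algebraic irrational multiplier `β`. -/
def InLWClass {n : ℕ} (z : Fin n → ℂ) : Prop :=
  ∃ (T : ℝ) (β : ℂ) (k : ℕ), DyadicHyper₂ T ∧ 0 < T ∧ IsAlgebraic ℚ β ∧
    β ∉ Set.range (algebraMap ℚ ℂ) ∧ Set.range z ⊆ dblMoments k β T

/-- `∀ r : ℚ, (r : ℂ) ≠ β` (for `{β : ℂ} (h : β ∉ Set.range (algebraMap ℚ ℂ))`). -/
private theorem ne_of_not_mem_range {β : ℂ} (h : β ∉ Set.range (algebraMap ℚ ℂ)) : ∀ r : ℚ, (r : ℂ) ≠ β :=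
  fun r hr => h ⟨r, (eq_ratCast _ r).trans hr⟩

/-- **CELL THEOREM — `S` ITSELF on the class, at every length `n`** (mod `hLW`, PROVED in the tree). -/
theorem schanuel_on_lwClass (hLW : LWMeasure) : ∀ (n : ℕ) (z : Fin n → ℂ), LinearIndependent ℚ z →
    InLWClass z →
      (n : Cardinal) ≤ Algebra.trdeg ℚ
        ↥(IntermediateField.adjoin ℚ (Set.range z ∪ Set.range (Complex.exp ∘ z))) := by
  intro n z hli hcl
  obtain ⟨T, β, k, hT, hT0, hβalg, hβirr, hz⟩ := hcl
  have hai := algebraicIndependent_lwPt hLW hβalg (ne_of_not_mem_range hβirr) hT hT0 k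
  classical
  have hzi : ∀ i, ∃ j : Fin k, z i = (T : ℂ) ^ ((j : ℕ) + 1) ∨ z i = β * (T : ℂ) ^ ((j : ℕ) + 1) :=
    fun i => hz ⟨i, rfl⟩
  have hE : ∀ i, (¬ ∃ j : Fin k, z i = (T : ℂ) ^ ((j : ℕ) + 1)) →
      ∃ j : Fin k, z i = β * (T : ℂ) ^ ((j : ℕ) + 1) := by
    intro i h
    obtain ⟨j, hj | hj⟩ := hzi i
    · exact absurd ⟨j, hj⟩ h
    · exact ⟨j, hj⟩
  -- the slot map `e : Fin n → Fin (k+k+1)` with `lwPt (e i) = exp (z i)`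
  let e : Fin n → Fin (k + k + 1) := fun i =>
    if h : ∃ j : Fin k, z i = (T : ℂ) ^ ((j : ℕ) + 1) then Fin.succ (Fin.castAdd k h.choose)
    else Fin.succ (Fin.natAdd k (hE i h).choose)
  have he : ∀ i, lwPt k β (T : ℂ) (e i) = cexp (z i) := by
    intro i
    by_cases h : ∃ j : Fin k, z i = (T : ℂ) ^ ((j : ℕ) + 1)
    · simp only [e, dif_pos h, lwPt_Y]; rw [← h.choose_spec]
    · simp only [e, dif_neg h, lwPt_E]; rw [← (hE i h).choose_spec]
  have hval : ∀ i, (∃ j : Fin k, z i = (T : ℂ) ^ ((j : ℕ) + 1)) → ((e i : ℕ)) < k + 1 := by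
    intro i h; simp only [e, dif_pos h, Fin.val_succ, Fin.val_castAdd]; omega
  have hval' : ∀ i, (¬ ∃ j : Fin k, z i = (T : ℂ) ^ ((j : ℕ) + 1)) → k + 1 ≤ ((e i : ℕ)) := by
    intro i h; simp only [e, dif_neg h, Fin.val_succ, Fin.val_natAdd]; omega
  have hinj : Function.Injective e := by
    intro i i' hii'
    apply hli.injective
    by_cases h : ∃ j : Fin k, z i = (T : ℂ) ^ ((j : ℕ) + 1) <;>
      by_cases h' : ∃ j : Fin k, z i' = (T : ℂ) ^ ((j : ℕ) + 1)
    · have h1 : h.choose = h'.choose := by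
        have := hii'; simp only [e, dif_pos h, dif_pos h'] at this
        exact Fin.castAdd_inj.mp (Fin.succ_inj.mp this)
      rw [h.choose_spec, h'.choose_spec, h1]
    · exfalso; have a := hval i h; have b := hval' i' h'; rw [hii'] at a; omega
    · exfalso; have a := hval' i h; have b := hval i' h'; rw [hii'] at a; omega
    · have h1 : (hE i h).choose = (hE i' h').choose := by
        have := hii'; simp only [e, dif_neg h, dif_neg h'] at this
        have hv := congrArg Fin.val (Fin.succ_inj.mp this)
        simp only [Fin.val_natAdd] at hv
        exact Fin.ext (by omega)
      rw [(hE i h).choose_spec, (hE i' h').choose_spec, h1]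
  refine sb_of_algebraicIndependent (hai.comp e hinj) (Fintype.card_fin n).ge fun i => ?_
  rw [Function.comp_apply, he i]
  exact IntermediateField.subset_adjoin ℚ _ (Set.mem_union_left _ (Set.mem_union_right _ ⟨i, rfl⟩))

/-- **CELL of item 25020 `DefectOneSchanuel`** — binders verbatim, ONE class line `InLWClass z` inserted;
derived in one line from `S` itself on the class. -/
theorem cell_25020 (hLW : LWMeasure) : ∀ (n : ℕ) (z : Fin n → ℂ), LinearIndependent ℚ z →
    InLWClass z →
      (n : Cardinal) ≤ Algebra.trdeg ℚ
        ↥(IntermediateField.adjoin ℚ (Set.range z ∪ Set.range (Complex.exp ∘ z))) + 1 :=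
  fun n z hli hcl => (schanuel_on_lwClass hLW n z hli hcl).trans le_self_add

/-- **CELL of item 31409 `EStableDefectOne`** — binders verbatim (E-stability and the first-failure
hypothesis CARRIED, not consumed), ONE class line `InLWClass z` inserted; one line from `S` itself. -/
theorem cell_31409 (hLW : LWMeasure) : ∀ (n : ℕ) (z : Fin n → ℂ), LinearIndependent ℚ z →
    (∃ β : ℂ, IsAlgebraic ℚ β ∧ β ∉ Set.range (algebraMap ℚ ℂ) ∧
      ∀ i, β * z i ∈ Submodule.span ℚ (Set.range z)) →
    (∀ (m : ℕ) (w : Fin m → ℂ), m < n → LinearIndependent ℚ w →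
      (∀ j, w j ∈ Submodule.span ℚ (Set.range z)) →
        (m : Cardinal) ≤ Algebra.trdeg ℚ
          ↥(IntermediateField.adjoin ℚ (Set.range w ∪ Set.range (Complex.exp ∘ w))) + 1) →
    InLWClass z →
      (n : Cardinal) ≤ Algebra.trdeg ℚ
        ↥(IntermediateField.adjoin ℚ (Set.range z ∪ Set.range (Complex.exp ∘ z))) + 1 :=
  fun n z hli _ _ hcl => cell_25020 hLW n z hli hcl

/-- **CELL of item 31410 `PlainDefectOne`** — same, with the plain-ness binder carried. -/
theorem cell_31410 (hLW : LWMeasure) : ∀ (n : ℕ) (z : Fin n → ℂ), LinearIndependent ℚ z →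
    (∀ β : ℂ, IsAlgebraic ℚ β → (∀ i, β * z i ∈ Submodule.span ℚ (Set.range z)) →
      β ∈ Set.range (algebraMap ℚ ℂ)) →
    (∀ (m : ℕ) (w : Fin m → ℂ), m < n → LinearIndependent ℚ w →
      (∀ j, w j ∈ Submodule.span ℚ (Set.range z)) →
        (m : Cardinal) ≤ Algebra.trdeg ℚ
          ↥(IntermediateField.adjoin ℚ (Set.range w ∪ Set.range (Complex.exp ∘ w))) + 1) →
    InLWClass z →
      (n : Cardinal) ≤ Algebra.trdeg ℚ
        ↥(IntermediateField.adjoin ℚ (Set.range z ∪ Set.range (Complex.exp ∘ z))) + 1 :=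
  fun n z hli _ _ hcl => cell_25020 hLW n z hli hcl

/-! ### The credit member `z₄ = (T⋆, iT⋆, T⋆², iT⋆²)` (n = 4; `β = i`, `k = 2`) -/

/-- **`z₄`** -/
def zStar : Fin 4 → ℂ := ![(Tstar : ℂ), I * Tstar, (Tstar : ℂ) ^ 2, I * (Tstar : ℂ) ^ 2]

/-- `zStar 0 = Tstar`. -/
@[simp] theorem zStar_0 : zStar 0 = Tstar := rfl
/-- `zStar 1 = I * Tstar`. -/
@[simp] theorem zStar_1 : zStar 1 = I * Tstar := rfl
/-- `zStar 2 = (Tstar : ℂ) ^ 2`. -/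
@[simp] theorem zStar_2 : zStar 2 = (Tstar : ℂ) ^ 2 := rfl
/-- `zStar 3 = I * (Tstar : ℂ) ^ 2`. -/
@[simp] theorem zStar_3 : zStar 3 = I * (Tstar : ℂ) ^ 2 := rfl

/-- `IsAlgebraic ℚ I`. -/
private theorem isAlgebraic_I : IsAlgebraic ℚ I := by
  refine ⟨Polynomial.X ^ 2 + Polynomial.C 1, Polynomial.X_pow_add_C_ne_zero (by norm_num) 1, ?_⟩
  simp [Complex.I_sq]

/-- `I ∉ Set.range (algebraMap ℚ ℂ)`. -/
private theorem I_not_mem_range : I ∉ Set.range (algebraMap ℚ ℂ) := by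
  rintro ⟨r, hr⟩
  have := congrArg Complex.im hr
  rw [eq_ratCast] at this
  simp at this

/-- `∀ i, P i` (for `{P : Fin 4 → Prop} (h0 : P 0) (h1 : P 1) (h2 : P 2) (h3 : P 3)`). -/
private theorem forall_fin_four {P : Fin 4 → Prop} (h0 : P 0) (h1 : P 1) (h2 : P 2) (h3 : P 3) : ∀ i, P i := by
  intro i
  fin_cases i <;> assumption

/-- `z₄` lies in the class (`T = T⋆`, `β = i`, `k = 2`). -/
theorem zStar_mem_class : InLWClass zStar := by
  refine ⟨Tstar, I, 2, dyadicHyper₂_Tstar, Tstar_pos, isAlgebraic_I, I_not_mem_range, ?_⟩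
  rintro x ⟨i, rfl⟩
  revert i
  refine forall_fin_four ?_ ?_ ?_ ?_
  · exact ⟨0, Or.inl (by simp)⟩
  · exact ⟨0, Or.inr (by simp)⟩
  · exact ⟨1, Or.inl (by simp)⟩
  · exact ⟨1, Or.inr (by simp)⟩

/-- over `ℚ`: `a T + c T² = 0` with `T` irrational forces `a = c = 0` -/
theorem coeffs_zero_of_irrational {T : ℝ} (hT0 : T ≠ 0) (hirr : Irrational T) {a c : ℚ}
    (h : (a : ℝ) * T + c * T ^ 2 = 0) : a = 0 ∧ c = 0 := by
  have h1 : (a : ℝ) + c * T = 0 := by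
    have : T * ((a : ℝ) + c * T) = 0 := by linear_combination h
    exact (mul_eq_zero.mp this).resolve_left hT0
  by_cases hc : c = 0
  · subst hc
    refine ⟨?_, rfl⟩
    have : (a : ℝ) = 0 := by simpa using h1
    exact_mod_cast this
  · exfalso
    refine hirr.ne_rat (-a / c) ?_
    have hc' : (c : ℝ) ≠ 0 := by exact_mod_cast hc
    rw [Rat.cast_div, Rat.cast_neg, eq_div_iff hc']
    linear_combination h1

/-- `z₄` is ℚ-linearly independent (PROVED from the irrationality of `T⋆`). -/
theorem linearIndependent_zStar : LinearIndependent ℚ zStar := by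
  rw [Fintype.linearIndependent_iff]
  intro g hg
  rw [Fin.sum_univ_four] at hg
  simp only [zStar_0, zStar_1, zStar_2, zStar_3, Algebra.smul_def, eq_ratCast] at hg
  have key : (((g 0 : ℝ) * Tstar + (g 2 : ℝ) * Tstar ^ 2 : ℝ) : ℂ) +
      (((g 1 : ℝ) * Tstar + (g 3 : ℝ) * Tstar ^ 2 : ℝ) : ℂ) * I = 0 := by
    push_cast
    linear_combination hg
  have hre := congrArg Complex.re key
  have him := congrArg Complex.im key
  simp only [Complex.add_re, Complex.ofReal_re, Complex.mul_re, Complex.I_re, mul_zero,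
    Complex.ofReal_im, Complex.I_im, sub_zero, add_zero, Complex.zero_re,
    Complex.add_im, Complex.mul_im, mul_one, zero_add, Complex.zero_im] at hre him
  obtain ⟨h0, h2⟩ := coeffs_zero_of_irrational Tstar_pos.ne' Tstar_irrational hre
  obtain ⟨h1, h3⟩ := coeffs_zero_of_irrational Tstar_pos.ne' Tstar_irrational him
  exact forall_fin_four h0 h1 h2 h3

/-- **E-stability of `z₄` (the binder of item 31409), shown satisfied with `β = i` (quadratic).** -/
theorem zStar_Estable : ∃ β : ℂ, IsAlgebraic ℚ β ∧ β ∉ Set.range (algebraMap ℚ ℂ) ∧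
    ∀ i, β * zStar i ∈ Submodule.span ℚ (Set.range zStar) := by
  refine ⟨I, isAlgebraic_I, I_not_mem_range, forall_fin_four ?_ ?_ ?_ ?_⟩
  · exact Submodule.subset_span ⟨1, by simp⟩
  · have e : I * zStar 1 = -zStar 0 := by
      rw [zStar_1, zStar_0, ← mul_assoc, Complex.I_mul_I]; ring
    rw [e]; exact Submodule.neg_mem _ (Submodule.subset_span ⟨0, rfl⟩)
  · exact Submodule.subset_span ⟨3, by simp⟩
  · have e : I * zStar 3 = -zStar 2 := by
      rw [zStar_3, zStar_2, ← mul_assoc, Complex.I_mul_I]; ring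
    rw [e]; exact Submodule.neg_mem _ (Submodule.subset_span ⟨2, rfl⟩)

/-- **THE CREDIT LINE — `S` ITSELF at the explicit length-4 tuple `z₄ = (T⋆, iT⋆, T⋆², iT⋆²)`:**
`trdeg_ℚ ℚ(z₄, e^{z₄}) ≥ 4` (mod `hLW`, PROVED in the tree; discharged in `LWTransportClosed.lean`). -/
theorem four_le_trdeg_zStar (hLW : LWMeasure) :
    (4 : Cardinal) ≤ Algebra.trdeg ℚ
      ↥(IntermediateField.adjoin ℚ (Set.range zStar ∪ Set.range (Complex.exp ∘ zStar))) := by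
  have h := schanuel_on_lwClass hLW 4 zStar linearIndependent_zStar zStar_mem_class
  exact_mod_cast h

/-- Item 31409 APPLIED at the member: its E-stability binder is met by `zStar_Estable`, its conclusion
(defect ≤ 1) follows from the credit line. -/
theorem item31409_at_zStar (hLW : LWMeasure) :
    ((4 : ℕ) : Cardinal) ≤ Algebra.trdeg ℚ
      ↥(IntermediateField.adjoin ℚ (Set.range zStar ∪ Set.range (Complex.exp ∘ zStar))) + 1 :=
  cell_25020 hLW 4 zStar linearIndependent_zStar zStar_mem_class

/-! ## §5b  The explicit member FAMILY `z_{2k}(β) = (T⋆, …, T⋆^k, βT⋆, …, βT⋆^k)` — `S` ITSELF at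
every EVEN length `n = 2k`, for every algebraic irrational `β` (F2 table, `k ≥ 3` included) -/

/-- `(a : ℚ) + (b : ℚ)·β = 0` with `β ∉ ℚ` forces `a = b = 0`. -/
theorem rat_pair_eq_zero {β : ℂ} (hβirr : β ∉ Set.range (algebraMap ℚ ℂ)) {a b : ℚ}
    (h : algebraMap ℚ ℂ a + algebraMap ℚ ℂ b * β = 0) : a = 0 ∧ b = 0 := by
  by_cases hb : b = 0
  · subst hb
    simp only [map_zero, zero_mul, add_zero, map_eq_zero] at h
    exact ⟨h, rfl⟩
  · exfalso
    refine hβirr ⟨-a / b, ?_⟩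
    have hb' : algebraMap ℚ ℂ b ≠ 0 := by simpa using hb
    rw [map_div₀, map_neg, div_eq_iff hb']
    linear_combination -h

/-- **`z_{2k}(β, T)`** := `(T, T², …, T^k, βT, βT², …, βT^k)`. -/
def zTwin (k : ℕ) (β : ℂ) (T : ℝ) : Fin (k + k) → ℂ :=
  Fin.append (fun j : Fin k => (T : ℂ) ^ ((j : ℕ) + 1)) (fun j : Fin k => β * (T : ℂ) ^ ((j : ℕ) + 1))

/-- `zTwin k β T (Fin.castAdd k j) = (T : ℂ) ^ ((j : ℕ) + 1)` (for `(k : ℕ) (β : ℂ) (T : ℝ) (j : Fin k)`). -/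
@[simp] theorem zTwin_left (k : ℕ) (β : ℂ) (T : ℝ) (j : Fin k) :
    zTwin k β T (Fin.castAdd k j) = (T : ℂ) ^ ((j : ℕ) + 1) := by
  unfold zTwin; rw [Fin.append_left]

/-- `zTwin k β T (Fin.natAdd k j) = β * (T : ℂ) ^ ((j : ℕ) + 1)` (for `(k : ℕ) (β : ℂ) (T : ℝ) (j : Fin k)`). -/
@[simp] theorem zTwin_right (k : ℕ) (β : ℂ) (T : ℝ) (j : Fin k) :
    zTwin k β T (Fin.natAdd k j) = β * (T : ℂ) ^ ((j : ℕ) + 1) := by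
  unfold zTwin; rw [Fin.append_right]

/-- **ℚ-freeness of `z_{2k}(β, T)`** for `T` transcendental and `β` algebraic irrational (PROVED:
`Σ_j (a_j + b_j β) T^j = 0` is a polynomial relation over `ℚ(β)`, over which `T` stays transcendental
(`Transcendental.extendScalars`), so `a_j + b_j β = 0`, so `a_j = b_j = 0`). -/
theorem linearIndependent_zTwin {T : ℝ} (hT : Transcendental ℚ (T : ℂ)) {β : ℂ}
    (hβalg : IsAlgebraic ℚ β) (hβirr : β ∉ Set.range (algebraMap ℚ ℂ)) (k : ℕ) :
    LinearIndependent ℚ (zTwin k β T) := by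
  classical
  let K : IntermediateField ℚ ℂ := IntermediateField.adjoin ℚ {β}
  haveI : FiniteDimensional ℚ K :=
    IntermediateField.adjoin.finiteDimensional (isAlgebraic_iff_isIntegral.mp hβalg)
  have hTK : Transcendental K (T : ℂ) := hT.extendScalars K
  have hβK : β ∈ K := IntermediateField.mem_adjoin_simple_self ℚ β
  rw [Fintype.linearIndependent_iff]
  intro g hg
  rw [Fin.sum_univ_add] at hg
  simp only [zTwin_left, zTwin_right, Algebra.smul_def] at hg
  let c : Fin k → K := fun j =>
    ⟨algebraMap ℚ ℂ (g (Fin.castAdd k j)) + algebraMap ℚ ℂ (g (Fin.natAdd k j)) * β,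
      add_mem (IntermediateField.algebraMap_mem K _) (mul_mem (IntermediateField.algebraMap_mem K _) hβK)⟩
  have hcdef : ∀ j, (c j : ℂ) =
      algebraMap ℚ ℂ (g (Fin.castAdd k j)) + algebraMap ℚ ℂ (g (Fin.natAdd k j)) * β := fun j => rfl
  have hp0 : (∑ j : Fin k, Polynomial.C (c j) * Polynomial.X ^ ((j : ℕ) + 1) : Polynomial K) = 0 := by
    by_contra hne
    refine hTK ⟨_, hne, ?_⟩
    simp only [map_sum, map_mul, map_pow, Polynomial.aeval_C, Polynomial.aeval_X,
      IntermediateField.algebraMap_apply]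
    rw [← hg, ← Finset.sum_add_distrib]
    exact Finset.sum_congr rfl fun j _ => by rw [hcdef]; ring
  have hc : ∀ j, c j = 0 := by
    intro j
    have h := congrArg (fun q : Polynomial K => q.coeff ((j : ℕ) + 1)) hp0
    simp only [Polynomial.finsetSum_coeff, Polynomial.coeff_C_mul_X_pow, Polynomial.coeff_zero] at h
    rw [Finset.sum_eq_single j (fun b _ hb => if_neg fun e => hb (Fin.ext (by omega))) (by simp)] at h
    simpa using h
  have hg2 : ∀ j, g (Fin.castAdd k j) = 0 ∧ g (Fin.natAdd k j) = 0 := fun j =>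
    rat_pair_eq_zero hβirr (by rw [← hcdef, hc j]; rfl)
  intro i
  exact Fin.addCases (motive := fun i => g i = 0) (fun j => (hg2 j).1) (fun j => (hg2 j).2) i

/-- `InLWClass (zTwin k β Tstar)`. -/
theorem zTwin_mem_class {β : ℂ} (hβalg : IsAlgebraic ℚ β) (hβirr : β ∉ Set.range (algebraMap ℚ ℂ))
    (k : ℕ) : InLWClass (zTwin k β Tstar) := by
  refine ⟨Tstar, β, k, dyadicHyper₂_Tstar, Tstar_pos, hβalg, hβirr, ?_⟩
  rintro x ⟨i, rfl⟩
  refine Fin.addCases (motive := fun i => zTwin k β Tstar i ∈ dblMoments k β Tstar)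
    (fun j => ⟨j, Or.inl (zTwin_left k β Tstar j)⟩) (fun j => ⟨j, Or.inr (zTwin_right k β Tstar j)⟩) i

/-- **THE MEMBER FAMILY — `S` ITSELF at length `2k`, every `k`, every algebraic irrational `β`:**
`trdeg_ℚ ℚ(z_{2k}, e^{z_{2k}}) ≥ 2k` for `z_{2k} = (T⋆, …, T⋆^k, βT⋆, …, βT⋆^k)` (mod `hLW`).
F2 table: n = 2k = 4, 6, 8, … all closed here; the tree decides such tuples only for n ≤ 3. -/
theorem schanuel_zTwin (hLW : LWMeasure) {β : ℂ} (hβalg : IsAlgebraic ℚ β)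
    (hβirr : β ∉ Set.range (algebraMap ℚ ℂ)) (k : ℕ) :
    ((k + k : ℕ) : Cardinal) ≤ Algebra.trdeg ℚ
      ↥(IntermediateField.adjoin ℚ (Set.range (zTwin k β Tstar) ∪
        Set.range (Complex.exp ∘ zTwin k β Tstar))) :=
  schanuel_on_lwClass hLW (k + k) _ (linearIndependent_zTwin Tstar_transcendental hβalg hβirr k)
    (zTwin_mem_class hβalg hβirr k)

/-- `InLWClass (zTwin k β T)`. -/
theorem zTwin_mem_class' {T : ℝ} (hT : DyadicHyper₂ T) (hT0 : 0 < T) {β : ℂ}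
    (hβalg : IsAlgebraic ℚ β) (hβirr : β ∉ Set.range (algebraMap ℚ ℂ)) (k : ℕ) :
    InLWClass (zTwin k β T) := by
  refine ⟨T, β, k, hT, hT0, hβalg, hβirr, ?_⟩
  rintro x ⟨i, rfl⟩
  refine Fin.addCases (motive := fun i => zTwin k β T i ∈ dblMoments k β T)
    (fun j => ⟨j, Or.inl (zTwin_left k β T j)⟩) (fun j => ⟨j, Or.inr (zTwin_right k β T j)⟩) i

/-- **… and at EVERY scale `T` of the class** (any dyadic 2-fold hyper-Liouville `T > 0`): `S` itself for
`(T, …, T^k, βT, …, βT^k)`, `n = 2k`, mod `hLW`. -/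
theorem schanuel_zTwin_of_dyadicHyper₂ (hLW : LWMeasure) {T : ℝ} (hT : DyadicHyper₂ T)
    (hT0 : 0 < T) {β : ℂ} (hβalg : IsAlgebraic ℚ β) (hβirr : β ∉ Set.range (algebraMap ℚ ℂ))
    (k : ℕ) :
    ((k + k : ℕ) : Cardinal) ≤ Algebra.trdeg ℚ
      ↥(IntermediateField.adjoin ℚ (Set.range (zTwin k β T) ∪
        Set.range (Complex.exp ∘ zTwin k β T))) :=
  schanuel_on_lwClass hLW (k + k) _
    (linearIndependent_zTwin hT.transcendental_complex hβalg hβirr k)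
    (zTwin_mem_class' hT hT0 hβalg hβirr k)

/-- e.g. `n = 6`: `(T⋆, T⋆², T⋆³, iT⋆, iT⋆², iT⋆³)`. -/
theorem six_le_trdeg_zTwin3I (hLW : LWMeasure) :
    ((6 : ℕ) : Cardinal) ≤ Algebra.trdeg ℚ
      ↥(IntermediateField.adjoin ℚ (Set.range (zTwin 3 I Tstar) ∪
        Set.range (Complex.exp ∘ zTwin 3 I Tstar))) :=
  schanuel_zTwin hLW isAlgebraic_I I_not_mem_range 3

end Summit.Schanuel.Schanuel.Theorems.RootDecomp1ELWTransport

end
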